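import Literature.NumberTheory.Sieve.HeathBrownCubicTypeIProofs
import Literature.NumberTheory.Sieve.HeathBrownMorozClassMoebius
import HarnessLib

/-!
# The head of the class Type-I estimate, I: regrouping by `S = (R, g)` (HB 2001 §5 p. 32)

Pure-proof file in the residue-class ("coset") port of D. R. Heath-Brown, *Primes represented by
`x³ + 2y³`*, Acta Math. 186 (2001), §5 pp. 30–32, to the class `x ≡ a, y ≡ b (mod d)` of
Heath-Brown–Moroz, Proc. LMS 88 (2004), §2 (`CubicSieve.classCountA`, `classLatticeCount`).
After the Möbius inversion `classCountA_eq_sum_moebius` (class (5.3)) and the split at `Δ`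
(`abs_classCountA_sub_mainTerm_le`), the head `g ≤ Δ` consists, for `g` coprime to `d`, of
`∑_{Q<N(R)≤2Q, R∈𝒯r} τ(R)^A |S_g(R) − [(d,N R)=1] η²X²N((R,g))/(g²d²N(R))|`,
`S_g(R) = #{x', y' ∈ (X/g, X(1+η)/g] : gx' ≡ a, gy' ≡ b (d), R ∣ (g)(x' + y'2^{1/3})}`.  This file
regroups it by `S = (R, g)`, `R = ST` exactly as on p. 32 (`sum_trBlock_head_le` of
`HeathBrownCubicTypeIProofs`): the class condition becomes `x' ≡ a', y' ≡ b'` for the reduced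
class `(a', b') = g⁻¹(a, b)` (`card_filter_mul_modEq_eq`) and `[(d, N R) = 1]` becomes
`[(d, N T) = 1]` (`N(S) = (N(R), g)` is coprime to `d`), so that the inner sums are exactly those
of the class Lemma 5.1 (`HeathBrownMorozClassLemma51`) at `(X/g, Q/N(S))`.
Content: `class_sum_trBlock_head_le`.  Constants: none.  [cite: HeathBrownMoroz2004, Lemma 2.3]
[cite: HeathBrownActa2001, §5 p. 32]  Search: `lean search 'trBlock_head'` — only the `d = 1`
version `sum_trBlock_head_le`.
-/

noncomputable section

open NumberField Finset Filter

open scoped Topology ArithmeticFunction.sigma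

namespace Literature.NumberTheory.Sieve.CubicSieve

open LFunctions.CubeRootTwoField CubicPrimes

/-! ### The regrouping `S = (R, g)` for the class -/

open scoped Classical in
/-- **The head of the class (5.3) regrouped by `S = (R, g)`** (p. 32, for the class): for
`g ≥ 1` coprime to `d`, the reduced class `(a', b') = g⁻¹(a, b)` and `Q > 0`,
`∑_{R∈𝒯r(Q)} τ(R)^A |S_g(R) − [(g,d)=1][(d,N R)=1] η²X²N((R,g))/(g²d²N(R))|
 ≤ ∑_{S∣(g)} τ(S)^A ∑_{T∈𝒯r(Q/N S)} τ(T)^A |S_{d,(a',b')}(T; X/g) − [(d,N T)=1]η²(X/g)²/(d²N T)|`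
(`R ↦ R/(R,g)` injective on fibres, `R ∣ (g)I ⟺ T ∣ I`, `N(R) = N(S)N(T)`, `N(S) = (N(R), g)`
coprime to `d`, `τ(R) ≤ τ(S)τ(T)`).
[cite: HeathBrownMoroz2004, Lemma 2.3] [cite: HeathBrownActa2001, §5 p. 32] -/
theorem class_sum_trBlock_head_le (X η : ℝ) {Q : ℝ} (hQ : 0 < Q) {g d a b a' b' : ℕ} (hg : 0 < g)
    (hgd : Nat.Coprime g d) (ha : ∀ x : ℕ, g * x ≡ a [MOD d] ↔ x ≡ a' [MOD d])
    (hb : ∀ y : ℕ, g * y ≡ b [MOD d] ↔ y ≡ b' [MOD d]) (A : ℕ) :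
    ∑ R ∈ (idealsLE ⌊2 * Q⌋₊).filter (fun R => Q < (Ideal.absNorm R : ℝ) ∧
        (Ideal.absNorm R : ℝ) ≤ 2 * Q ∧ Squarefree (Ideal.absNorm R)),
      (idealDivisorCount R : ℝ) ^ A *
        |(#{xy ∈ latticeBox (X / g) η | g * xy.1 ≡ a [MOD d] ∧ g * xy.2 ≡ b [MOD d] ∧
            R ∣ Ideal.span {(g : 𝓞 K)} * pairIdeal xy} : ℝ) -
          (if Nat.Coprime g d ∧ Nat.Coprime d (Ideal.absNorm R) then
            η ^ 2 * X ^ 2 * Ideal.absNorm (R ⊔ Ideal.span {(g : 𝓞 K)}) /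
              ((g : ℝ) ^ 2 * (d : ℝ) ^ 2 * Ideal.absNorm R) else 0)| ≤
    ∑ S ∈ (idealsLE (Ideal.absNorm (Ideal.span {(g : 𝓞 K)}))).filter (· ∣ Ideal.span {(g : 𝓞 K)}),
      (idealDivisorCount S : ℝ) ^ A *
        ∑ T ∈ (idealsLE ⌊2 * (Q / Ideal.absNorm S)⌋₊).filter (fun T =>
            Q / Ideal.absNorm S < (Ideal.absNorm T : ℝ) ∧
              (Ideal.absNorm T : ℝ) ≤ 2 * (Q / Ideal.absNorm S) ∧ Squarefree (Ideal.absNorm T)),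
          (idealDivisorCount T : ℝ) ^ A *
            |(classLatticeCount (X / g) η d a' b' T : ℝ) -
              (if Nat.Coprime d (Ideal.absNorm T) then
                η ^ 2 * (X / g) ^ 2 / ((d : ℝ) ^ 2 * Ideal.absNorm T) else 0)| := by
  set Sg : Ideal (𝓞 K) := Ideal.span {(g : 𝓞 K)} with hSg
  have hSg0 : Sg ≠ ⊥ := span_natCast_ne_bot hg
  set tr : ℝ → Finset (Ideal (𝓞 K)) := fun Q' => (idealsLE ⌊2 * Q'⌋₊).filter (fun R =>
    Q' < (Ideal.absNorm R : ℝ) ∧ (Ideal.absNorm R : ℝ) ≤ 2 * Q' ∧ Squarefree (Ideal.absNorm R))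
    with htr
  set Dv := (idealsLE (Ideal.absNorm Sg)).filter (· ∣ Sg) with hDv
  set G : Ideal (𝓞 K) → ℝ := fun T => (idealDivisorCount T : ℝ) ^ A *
    |(classLatticeCount (X / g) η d a' b' T : ℝ) -
      (if Nat.Coprime d (Ideal.absNorm T) then
        η ^ 2 * (X / g) ^ 2 / ((d : ℝ) ^ 2 * Ideal.absNorm T) else 0)| with hG
  -- the cofactor `T = R/(R,g)`
  set e : Ideal (𝓞 K) → Ideal (𝓞 K) := fun R => Classical.choose (exists_eq_sup_mul R (g : 𝓞 K))
    with he
  have he_spec : ∀ R, R = (R ⊔ Sg) * e R := fun R =>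
    Classical.choose_spec (exists_eq_sup_mul R (g : 𝓞 K))
  -- fibre decomposition by `S = R ⊔ (g)`
  have hmaps : ∀ R ∈ tr Q, R ⊔ Sg ∈ Dv := fun R _ =>
    (mem_filter_dvd_idealsLE_iff hSg0).mpr (Ideal.dvd_iff_le.mpr le_sup_right)
  change ∑ R ∈ tr Q, (idealDivisorCount R : ℝ) ^ A * _ ≤
    ∑ S ∈ Dv, (idealDivisorCount S : ℝ) ^ A * ∑ T ∈ tr (Q / Ideal.absNorm S), G T
  rw [← sum_fiberwise_of_maps_to hmaps]
  refine sum_le_sum fun S hS => ?_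
  have hS0 : S ≠ ⊥ := by
    rintro rfl
    exact hSg0 (zero_dvd_iff.mp ((mem_filter_dvd_idealsLE_iff hSg0).mp hS))
  have hNS : (0 : ℝ) < Ideal.absNorm S := by
    have : Ideal.absNorm S ≠ 0 := fun h => hS0 (Ideal.absNorm_eq_zero_iff.mp h)
    positivity
  -- properties of members of the fibre
  have hfib : ∀ R ∈ (tr Q).filter (fun R => R ⊔ Sg = S),
      R = S * e R ∧ Squarefree (Ideal.absNorm R) ∧ Q < (Ideal.absNorm R : ℝ) ∧
        (Ideal.absNorm R : ℝ) ≤ 2 * Q ∧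
        Ideal.absNorm R = Ideal.absNorm S * Ideal.absNorm (e R) := by
    intro R hR
    rw [mem_filter, htr, mem_filter] at hR
    obtain ⟨⟨-, hQ1, hQ2, hsq⟩, hRS⟩ := hR
    have h := he_spec R
    rw [hRS] at h
    refine ⟨h, hsq, hQ1, hQ2, ?_⟩
    have hN := congr_arg Ideal.absNorm h
    rwa [map_mul] at hN
  have hmem : ∀ R ∈ (tr Q).filter (fun R => R ⊔ Sg = S), e R ∈ tr (Q / Ideal.absNorm S) := by
    intro R hR
    obtain ⟨hRST, hsq, hQ1, hQ2, hNRnat⟩ := hfib R hR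
    have hNR : (Ideal.absNorm R : ℝ) = Ideal.absNorm S * Ideal.absNorm (e R) := by
      exact_mod_cast hNRnat
    have hNT1 : Q / Ideal.absNorm S < Ideal.absNorm (e R) := by
      rw [div_lt_iff₀' hNS, ← hNR]; exact hQ1
    have hNT2 : (Ideal.absNorm (e R) : ℝ) ≤ 2 * (Q / Ideal.absNorm S) := by
      rw [mul_div_assoc', le_div_iff₀' hNS, ← hNR]; exact hQ2
    rw [htr, mem_filter, mem_idealsLE]
    refine ⟨Nat.le_floor hNT2, hNT1, hNT2, ?_⟩
    exact Squarefree.squarefree_of_dvd ⟨Ideal.absNorm S, by rw [hNRnat, mul_comm]⟩ hsq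
  have hinj : Set.InjOn e ↑((tr Q).filter (fun R => R ⊔ Sg = S)) := by
    intro R₁ h₁ R₂ h₂ h12
    rw [mem_coe] at h₁ h₂
    rw [(hfib R₁ h₁).1, (hfib R₂ h₂).1, h12]
  -- pointwise comparison of the summands
  have hpt : ∀ R ∈ (tr Q).filter (fun R => R ⊔ Sg = S),
      (idealDivisorCount R : ℝ) ^ A *
        |(#{xy ∈ latticeBox (X / g) η | g * xy.1 ≡ a [MOD d] ∧ g * xy.2 ≡ b [MOD d] ∧
            R ∣ Sg * pairIdeal xy} : ℝ) -
          (if Nat.Coprime g d ∧ Nat.Coprime d (Ideal.absNorm R) then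
            η ^ 2 * X ^ 2 * Ideal.absNorm (R ⊔ Sg) / ((g : ℝ) ^ 2 * (d : ℝ) ^ 2 * Ideal.absNorm R)
            else 0)| ≤
        (idealDivisorCount S : ℝ) ^ A * G (e R) := by
    intro R hR
    obtain ⟨hRST, hsq, hQ1, -, hNRnat⟩ := hfib R hR
    have hRS : R ⊔ Sg = S := (mem_filter.mp hR).2
    have hR0 : R ≠ ⊥ := fun h => by
      rw [h, Ideal.absNorm_bot, Nat.cast_zero] at hQ1
      linarith
    have hT0 : e R ≠ ⊥ := fun h0 => hR0 (by rw [hRST, h0, Ideal.mul_bot])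
    have hRST' : R = (R ⊔ Sg) * e R := by rw [hRS]; exact hRST
    have hcop : IsCoprime (e R) Sg :=
      isCoprime_span_of_eq_sup_mul (squarefree_of_squarefree_absNorm hsq) hRST'
    -- the count
    have hcount : #{xy ∈ latticeBox (X / g) η | g * xy.1 ≡ a [MOD d] ∧ g * xy.2 ≡ b [MOD d] ∧
        R ∣ Sg * pairIdeal xy} = classLatticeCount (X / g) η d a' b' (e R) := by
      have hc := card_filter_mul_modEq_eq (Y := X / g) (η := η) ha hb
        (fun xy => R ∣ Sg * pairIdeal xy)
      rw [hc, classLatticeCount]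
      congr 1
      refine filter_congr fun xy _ => ?_
      rw [dvd_span_mul_iff hRST' hcop]
    -- the norms and the indicator
    have hNR : (Ideal.absNorm R : ℝ) = Ideal.absNorm S * Ideal.absNorm (e R) := by
      exact_mod_cast hNRnat
    have hNT : (0 : ℝ) < Ideal.absNorm (e R) := by
      have : Ideal.absNorm (e R) ≠ 0 := fun h => hT0 (Ideal.absNorm_eq_zero_iff.mp h)
      positivity
    have hg' : (0 : ℝ) < g := by exact_mod_cast hg
    have hdS : Nat.Coprime d (Ideal.absNorm S) := by
      rw [← hRS, absNorm_sup_span_natCast hsq g]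
      exact Nat.Coprime.coprime_dvd_right (Nat.gcd_dvd_right _ g) hgd.symm
    have hind : (Nat.Coprime g d ∧ Nat.Coprime d (Ideal.absNorm R)) ↔
        Nat.Coprime d (Ideal.absNorm (e R)) := by
      rw [hNRnat, Nat.coprime_mul_iff_right]
      exact ⟨fun h => h.2.2, fun h => ⟨hgd, hdS, h⟩⟩
    have hmain : (if Nat.Coprime g d ∧ Nat.Coprime d (Ideal.absNorm R) then
        η ^ 2 * X ^ 2 * Ideal.absNorm (R ⊔ Sg) / ((g : ℝ) ^ 2 * (d : ℝ) ^ 2 * Ideal.absNorm R)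
        else 0) =
        if Nat.Coprime d (Ideal.absNorm (e R)) then
          η ^ 2 * (X / g) ^ 2 / ((d : ℝ) ^ 2 * Ideal.absNorm (e R)) else 0 := by
      rw [if_congr hind rfl rfl]
      split_ifs
      · rw [hRS, hNR]
        field_simp
      · rfl
    rw [hcount, hmain, hG]
    simp only
    rw [← mul_assoc]
    refine mul_le_mul_of_nonneg_right ?_ (abs_nonneg _)
    rw [← mul_pow]
    refine pow_le_pow_left₀ (Nat.cast_nonneg _) ?_ A
    have hτ : idealDivisorCount R ≤ idealDivisorCount S * idealDivisorCount (e R) := by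
      have h := idealDivisorCount_mul_le hS0 hT0
      rwa [← hRST] at h
    exact_mod_cast hτ
  calc ∑ R ∈ (tr Q).filter (fun R => R ⊔ Sg = S), (idealDivisorCount R : ℝ) ^ A *
          |(#{xy ∈ latticeBox (X / g) η | g * xy.1 ≡ a [MOD d] ∧ g * xy.2 ≡ b [MOD d] ∧
              R ∣ Sg * pairIdeal xy} : ℝ) -
            (if Nat.Coprime g d ∧ Nat.Coprime d (Ideal.absNorm R) then
              η ^ 2 * X ^ 2 * Ideal.absNorm (R ⊔ Sg) / ((g : ℝ) ^ 2 * (d : ℝ) ^ 2 * Ideal.absNorm R)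
              else 0)|
      ≤ ∑ R ∈ (tr Q).filter (fun R => R ⊔ Sg = S), (idealDivisorCount S : ℝ) ^ A * G (e R) :=
        sum_le_sum hpt
    _ = (idealDivisorCount S : ℝ) ^ A *
          ∑ T ∈ ((tr Q).filter (fun R => R ⊔ Sg = S)).image e, G T := by
        rw [mul_sum, sum_image hinj]
    _ ≤ (idealDivisorCount S : ℝ) ^ A * ∑ T ∈ tr (Q / Ideal.absNorm S), G T := by
        refine mul_le_mul_of_nonneg_left ?_ (by positivity)
        refine sum_le_sum_of_subset_of_nonneg (fun T hT => ?_) fun T _ _ => by positivity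
        rw [mem_image] at hT
        obtain ⟨R, hR, rfl⟩ := hT
        exact hmem R hR

end Literature.NumberTheory.Sieve.CubicSieve

end
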